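import Literature.Analysis.FluidPDE.PassiveScalarDiagMild
import HarnessLib

/-!
# Mild (Duhamel) formulation of the passive scalar equation with constant diagonal diffusion and
  bounded drift, II: the transport coefficient and the Duhamel integral

Analysis/FluidPDE proof-support file (everything proved), sequel of `PassiveScalarDiagMild` (see its
module docstring for the construction). For a drift bounded by `U` on `(0,T) × T^d`
(`Torus.DriftBound`) and a field `θ` with `∫ θ(t)² ≤ E` at every `t ∈ [0,T]` (`Torus.IsL2Field`):

* the transport coefficient `N(θ)(s)(k) = ∑ⱼ 2πi kⱼ 𝓕(uⱼ(s)θ(s))(k)` (`Torus.transportCoeff`) is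
  integrable in time at every frequency (Fubini: `uⱼθ ∈ L¹((0,T) × T^d)`), the slices `uⱼ(s)θ(s)`
  are in `L²` with `∫(uⱼθ)(s)² ≤ U²E` for a.e. `s`; the pointwise Cauchy–Schwarz bound
  `‖N(θ)(s)(k)‖² ≤ 4π² Qₐ(k) ∑ⱼ aⱼ⁻¹ ‖𝓕(uⱼ(s)θ(s))(k)‖²` (`norm_sq_transportCoeff_le`); conjugate
  symmetry `N(-k) = conj N(k)`; linearity and homogeneity in the field;
* the damped Duhamel coefficient `D^λ(θ)(t)(k) = ∫_{(0,t]} e^{-(νₖ+λ)(t-s)} N(θ)(s)(k) ds`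
  (`Torus.duhamelCoeff`): the factorisation `e^{-(νₖ+λ)t} ∫ e^{(νₖ+λ)s} N`, continuity in
  `t ∈ [0,T]`, conjugate symmetry, linearity in the field, and the undamping identity
  `D⁰(e^{λ·}w)(t) = e^{λt} D^λ(w)(t)`; the same for the Picard map `Torus.mildMap`.

## References

* A. Pazy, *Semigroups of Linear Operators and Applications to Partial Differential Equations*,
  Springer 1983, Ch. 4 §4.2 (mild solutions, Duhamel's formula (2.3), Def. 2.3, Cor. 2.5).
* L. C. Evans, *Partial Differential Equations*, 2nd ed. (AMS 2010), §7.1.2–7.1.3.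
* R. J. DiPerna, P.-L. Lions, Invent. Math. 98 (1989) 511–547, §II.1 (the weak class).
* L. Grafakos, *Classical Fourier Analysis*, 3rd ed. (2014), Prop. 3.2.6 (4), (8), Prop. 3.2.7 (3).
-/

noncomputable section

open MeasureTheory TopologicalSpace Set Function Filter UnitAddTorus
open _root_.Topology
open scoped ENNReal NNReal InnerProductSpace ComplexConjugate

namespace Literature.Analysis.FluidPDE

namespace Torus

open Literature.Analysis.FunctionSpaces.Torus Literature.Analysis.FunctionSpaces

variable {d : Type*} [Fintype d]

/-! ## The transport coefficient: integrability in time, pointwise bound, symmetry, linearity -/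

section Transport

variable {T U E : ℝ} {u : ℝ → UnitAddTorus d → EuclideanSpace ℝ d} {θ θ' : ℝ → UnitAddTorus d → ℝ}

/-- A component of a bounded measurable drift is a.e. strongly measurable on `(0,T) × T^d`. [cite: DiPernaLions1989, §II.1 (12)–(14)] -/
theorem DriftBound.aestronglyMeasurable_apply (hu : DriftBound T u U) (j : d) :
    AEStronglyMeasurable (fun p : ℝ × UnitAddTorus d => u p.1 p.2 j)
      (((volume : Measure ℝ).restrict (Ioo 0 T)).prod volume) :=
  (EuclideanSpace.proj (𝕜 := ℝ) j).continuous.comp_aestronglyMeasurable hu.aestronglyMeasurable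

/-- **`uⱼ θ ∈ L¹((0,T) × T^d)`** for a bounded drift and an `L^∞_t L²_x` field (`|uⱼ| ≤ U` a.e.
and `θ` integrable on the finite measure space). [cite: DiPernaLions1989, §II.1 (12)–(14)] -/
theorem integrable_apply_mul (hu : DriftBound T u U) (hθ : IsL2Field T E θ) (j : d) :
    Integrable (fun p : ℝ × UnitAddTorus d => u p.1 p.2 j * θ p.1 p.2)
      (((volume : Measure ℝ).restrict (Ioo 0 T)).prod volume) := by
  refine hθ.integrable_uncurry.bdd_mul (c := U) (hu.aestronglyMeasurable_apply j) ?_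
  filter_upwards [hu.ae_abs_apply_le j] with p hp
  rwa [Real.norm_eq_abs]

/-- The character-weighted product `e_{-k}(x) (uⱼθ)(t,x)` is integrable on `(0,T) × T^d`. [cite: DiPernaLions1989, §II.1 (12)–(14)] -/
theorem integrable_mFourier_smul_apply_mul (hu : DriftBound T u U) (hθ : IsL2Field T E θ) (j : d)
    (k : d → ℤ) :
    Integrable (fun p : ℝ × UnitAddTorus d =>
        mFourier (-k) p.2 • (((u p.1 p.2 j * θ p.1 p.2 : ℝ) : ℂ)))
      (((volume : Measure ℝ).restrict (Ioo 0 T)).prod volume) := by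
  have h1 : Integrable (fun p : ℝ × UnitAddTorus d => (((u p.1 p.2 j * θ p.1 p.2 : ℝ) : ℂ)))
      (((volume : Measure ℝ).restrict (Ioo 0 T)).prod volume) := (integrable_apply_mul hu hθ j).ofReal
  refine h1.bdd_smul 1 ((mFourier (-k)).continuous.comp continuous_snd).aestronglyMeasurable ?_
  exact Eventually.of_forall fun p => ((mFourier (-k)).norm_coe_le_norm p.2).trans_eq mFourier_norm

/-- **The Fourier coefficients `t ↦ 𝓕(uⱼ(t)θ(t))(k)` are integrable in time** on `(0,T)`
(Fubini: the inner integral of an integrable function on the product). [cite: DiPernaLions1989, §II.1 (12)–(14)] -/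
theorem integrable_mFourierCoeff_apply_mul (hu : DriftBound T u U) (hθ : IsL2Field T E θ) (j : d)
    (k : d → ℤ) :
    Integrable (fun t => mFourierCoeff (fun x => ((u t x j * θ t x : ℝ) : ℂ)) k)
      ((volume : Measure ℝ).restrict (Ioo 0 T)) := by
  have h := (integrable_mFourier_smul_apply_mul hu hθ j k).integral_prod_left
  refine h.congr (ae_of_all _ fun t => ?_)
  exact (mFourierCoeff_eq_integral_volume _ k).symm

/-- **The transport coefficient is integrable in time** on `(0,T)` at every frequency. [cite: DiPernaLions1989, §II.1 (12)–(14)] -/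
theorem integrable_transportCoeff (hu : DriftBound T u U) (hθ : IsL2Field T E θ) (k : d → ℤ) :
    Integrable (fun t => transportCoeff u θ t k) ((volume : Measure ℝ).restrict (Ioo 0 T)) := by
  simp only [transportCoeff]
  exact integrable_finsetSum _ fun j _ => (integrable_mFourierCoeff_apply_mul hu hθ j k).const_mul _

/-- The slice `uⱼ(t) θ(t)` is in `L²(T^d)` with `∫ (uⱼθ)(t)² ≤ U² E`, for a.e. `t ∈ (0,T)`
(`|uⱼ(t,·)| ≤ U` a.e. for a.e. `t`). [cite: DiPernaLions1989, §II.1 (12)–(14)] -/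
theorem ae_memLp_apply_mul (hu : DriftBound T u U) (hθ : IsL2Field T E θ) (j : d) :
    ∀ᵐ t ∂((volume : Measure ℝ).restrict (Ioo 0 T)),
      MemLp (fun x => u t x j * θ t x) 2 volume ∧ ∫ x, (u t x j * θ t x) ^ 2 ≤ U ^ 2 * E := by
  have hs : ∀ᵐ t ∂((volume : Measure ℝ).restrict (Ioo 0 T)),
      AEStronglyMeasurable (fun x => u t x j) volume := (hu.aestronglyMeasurable_apply j).prodMk_left
  filter_upwards [hs, Measure.ae_ae_of_ae_prod (hu.ae_abs_apply_le j), ae_restrict_mem measurableSet_Ioo]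
    with t hts htb htI
  have htI' : t ∈ Icc 0 T := Ioo_subset_Icc_self htI
  have hθt : MemLp (θ t) 2 volume := hθ.memLp t htI'
  have hm : MemLp (fun x => u t x j * θ t x) 2 volume := by
    refine (hθt.norm.const_mul U).mono' (hts.mul hθt.1) ?_
    filter_upwards [htb] with x hx
    rw [norm_mul, Real.norm_eq_abs]
    exact mul_le_mul_of_nonneg_right hx (norm_nonneg _)
  refine ⟨hm, ?_⟩
  calc ∫ x, (u t x j * θ t x) ^ 2 ≤ ∫ x, U ^ 2 * θ t x ^ 2 := by
        refine integral_mono_ae (hm.integrable_sq) ((hθt.integrable_sq).const_mul _) ?_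
        filter_upwards [htb] with x hx
        rw [mul_pow]
        exact mul_le_mul_of_nonneg_right (sq_le_sq' (abs_le.1 hx).1 (abs_le.1 hx).2) (sq_nonneg _)
    _ = U ^ 2 * ∫ x, θ t x ^ 2 := integral_const_mul _ _
    _ ≤ U ^ 2 * E := mul_le_mul_of_nonneg_left (hθ.integral_sq_le t htI') (sq_nonneg _)

/-- **Pointwise Cauchy–Schwarz bound on the transport coefficient**: for `aⱼ > 0`,
`‖N(θ)(s)(k)‖² ≤ 4π² Qₐ(k) · ∑ⱼ aⱼ⁻¹ ‖𝓕(uⱼ(s)θ(s))(k)‖²`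
(`|∑ⱼ kⱼ zⱼ| ≤ (∑ⱼ aⱼkⱼ²)^{1/2} (∑ⱼ |zⱼ|²/aⱼ)^{1/2}`). This weighting is what makes the heat
factor `e^{-νₖ(t-s)}` regain the derivative uniformly in `k`: `4π²Qₐ(k)/(2νₖ) = 1/(2κ)`. [cite: Grafakos2014, Prop. 3.2.6 (8)] -/
theorem norm_sq_transportCoeff_le {a : d → ℝ} (ha : ∀ i, 0 < a i) (u : ℝ → UnitAddTorus d → EuclideanSpace ℝ d)
    (θ : ℝ → UnitAddTorus d → ℝ) (s : ℝ) (k : d → ℤ) :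
    ‖transportCoeff u θ s k‖ ^ 2 ≤ 4 * Real.pi ^ 2 * diagFreqSq a k *
      ∑ j, (a j)⁻¹ * ‖mFourierCoeff (fun x => ((u s x j * θ s x : ℝ) : ℂ)) k‖ ^ 2 := by
  set z : d → ℝ := fun j => ‖mFourierCoeff (fun x => ((u s x j * θ s x : ℝ) : ℂ)) k‖ with hz
  have hz0 : ∀ j, 0 ≤ z j := fun j => norm_nonneg _
  -- `‖N‖ ≤ 2π ∑ⱼ |kⱼ| zⱼ`
  have h1 : ‖transportCoeff u θ s k‖ ≤ 2 * Real.pi * ∑ j, |(k j : ℝ)| * z j := by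
    rw [transportCoeff_apply, Finset.mul_sum]
    refine (norm_sum_le _ _).trans (Finset.sum_le_sum fun j _ => ?_)
    rw [norm_mul]
    have : ‖(2 * Real.pi * Complex.I * (k j : ℂ) : ℂ)‖ = 2 * Real.pi * |(k j : ℝ)| := by
      rw [norm_mul, norm_mul, norm_mul, Complex.norm_I, mul_one, Complex.norm_ofNat,
        Complex.norm_real, Real.norm_of_nonneg Real.pi_pos.le, ← Int.cast_abs, Complex.norm_intCast,
        Int.cast_abs]
    rw [this, hz, mul_assoc]
  -- Cauchy–Schwarz with the weights `√aⱼ`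
  have h2 : (∑ j, |(k j : ℝ)| * z j) ^ 2 ≤ diagFreqSq a k * ∑ j, (a j)⁻¹ * z j ^ 2 := by
    have hcs := Finset.sum_mul_sq_le_sq_mul_sq Finset.univ
      (fun j => Real.sqrt (a j) * |(k j : ℝ)|) (fun j => z j / Real.sqrt (a j))
    have e1 : ∑ j, Real.sqrt (a j) * |(k j : ℝ)| * (z j / Real.sqrt (a j)) = ∑ j, |(k j : ℝ)| * z j := by
      refine Finset.sum_congr rfl fun j _ => ?_
      have : Real.sqrt (a j) ≠ 0 := (Real.sqrt_pos.2 (ha j)).ne'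
      field_simp
    have e2 : ∑ j, (Real.sqrt (a j) * |(k j : ℝ)|) ^ 2 = diagFreqSq a k := by
      rw [diagFreqSq_apply]
      refine Finset.sum_congr rfl fun j _ => ?_
      rw [mul_pow, Real.sq_sqrt (ha j).le, sq_abs]
    have e3 : ∑ j, (z j / Real.sqrt (a j)) ^ 2 = ∑ j, (a j)⁻¹ * z j ^ 2 := by
      refine Finset.sum_congr rfl fun j _ => ?_
      rw [div_pow, Real.sq_sqrt (ha j).le, div_eq_inv_mul]
    rw [e1, e2, e3] at hcs
    exact hcs
  have h0 : 0 ≤ ‖transportCoeff u θ s k‖ := norm_nonneg _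
  calc ‖transportCoeff u θ s k‖ ^ 2 ≤ (2 * Real.pi * ∑ j, |(k j : ℝ)| * z j) ^ 2 :=
        pow_le_pow_left₀ h0 h1 2
    _ = 4 * Real.pi ^ 2 * (∑ j, |(k j : ℝ)| * z j) ^ 2 := by ring
    _ ≤ 4 * Real.pi ^ 2 * (diagFreqSq a k * ∑ j, (a j)⁻¹ * z j ^ 2) := by
        gcongr
    _ = 4 * Real.pi ^ 2 * diagFreqSq a k * ∑ j, (a j)⁻¹ * z j ^ 2 := by ring

/-- **Conjugate symmetry of the transport coefficient**: `N(θ)(s)(-k) = conj (N(θ)(s)(k))`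
(real fields: `𝓕(f)(-k) = conj 𝓕(f)(k)` and `2πi(-kⱼ) = conj (2πi kⱼ)`). [cite: Grafakos2014, Prop. 3.2.6 (4)] -/
theorem transportCoeff_neg (u : ℝ → UnitAddTorus d → EuclideanSpace ℝ d) (θ : ℝ → UnitAddTorus d → ℝ)
    (s : ℝ) (k : d → ℤ) : transportCoeff u θ s (-k) = conj (transportCoeff u θ s k) := by
  rw [transportCoeff_apply, transportCoeff_apply, map_sum]
  refine Finset.sum_congr rfl fun j _ => ?_
  rw [map_mul, mFourierCoeff_ofReal_comp]
  congr 1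
  simp only [Pi.neg_apply, Int.cast_neg, map_mul, Complex.conj_I, Complex.conj_ofReal, map_ofNat,
    map_intCast]
  ring

/-- **Linearity of the transport coefficient in the field**, at times where both slices and the
drift slice are honest (`uⱼ(s)θ(s)`, `uⱼ(s)θ'(s)` integrable). [cite: Grafakos2014, Prop. 3.2.6 (8)] -/
theorem transportCoeff_sub {s : ℝ} (h : ∀ j, Integrable (fun x => u s x j * θ s x) volume)
    (h' : ∀ j, Integrable (fun x => u s x j * θ' s x) volume) (k : d → ℤ) :
    transportCoeff u (fun t x => θ t x - θ' t x) s k = transportCoeff u θ s k - transportCoeff u θ' s k := by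
  rw [transportCoeff_apply, transportCoeff_apply, transportCoeff_apply, ← Finset.sum_sub_distrib]
  refine Finset.sum_congr rfl fun j _ => ?_
  rw [← mul_sub]
  congr 1
  have e : (fun x => ((u s x j * (θ s x - θ' s x) : ℝ) : ℂ)) =
      (fun x => ((u s x j * θ s x : ℝ) : ℂ)) - fun x => ((u s x j * θ' s x : ℝ) : ℂ) := by
    funext x
    simp only [Pi.sub_apply]
    push_cast
    ring
  rw [e, mFourierCoeff_sub (h j).ofReal (h' j).ofReal]

/-- **Homogeneity of the transport coefficient** under a time-dependent scalar factor:
`N(f·θ)(s)(k) = f(s) N(θ)(s)(k)`. [cite: Grafakos2014, Prop. 3.2.6 (8)] -/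
theorem transportCoeff_mul_left (f : ℝ → ℝ) (u : ℝ → UnitAddTorus d → EuclideanSpace ℝ d)
    (θ : ℝ → UnitAddTorus d → ℝ) (s : ℝ) (k : d → ℤ) :
    transportCoeff u (fun t x => f t * θ t x) s k = (f s : ℂ) * transportCoeff u θ s k := by
  rw [transportCoeff_apply, transportCoeff_apply, Finset.mul_sum]
  refine Finset.sum_congr rfl fun j _ => ?_
  have e : (fun x => ((u s x j * (f s * θ s x) : ℝ) : ℂ)) =
      (f s : ℂ) • fun x => ((u s x j * θ s x : ℝ) : ℂ) := by
    funext x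
    simp only [Pi.smul_apply, smul_eq_mul]
    push_cast
    ring
  rw [e, mFourierCoeff_const_smul, smul_eq_mul]
  ring

end Transport

/-! ## The Duhamel coefficient: factorisation, continuity in time, symmetry, linearity -/

section Duhamel

variable {T U E κ lam : ℝ} {a : d → ℝ} {u : ℝ → UnitAddTorus d → EuclideanSpace ℝ d}
  {θ θ' : ℝ → UnitAddTorus d → ℝ}

/-- **Factorisation of the Duhamel kernel**:
`D^λ(θ)(t)(k) = e^{-(νₖ+λ)t} ∫_{(0,t]} e^{(νₖ+λ)s} N(θ)(s)(k) ds`. [cite: Pazy1983, Ch. 4 §4.2, (2.3) and Def. 2.3 (mild solution), p. 106] -/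
theorem duhamelCoeff_eq_exp_mul_integral (κ : ℝ) (a : d → ℝ) (lam : ℝ)
    (u : ℝ → UnitAddTorus d → EuclideanSpace ℝ d) (θ : ℝ → UnitAddTorus d → ℝ) (t : ℝ) (k : d → ℤ) :
    duhamelCoeff κ a lam u θ t k = ((Real.exp (-((diagRate κ a k + lam) * t)) : ℝ) : ℂ) *
      ∫ s in Ioc 0 t, ((Real.exp ((diagRate κ a k + lam) * s) : ℝ) : ℂ) * transportCoeff u θ s k := by
  rw [duhamelCoeff_apply, ← integral_const_mul]
  refine integral_congr_ae (ae_of_all _ fun s => ?_)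
  dsimp only
  rw [← mul_assoc, ← Complex.ofReal_mul, ← Real.exp_add]
  congr 3
  ring

/-- The transport coefficient is integrable on `[0,T]` (null endpoints). [cite: DiPernaLions1989, §II.1 (12)–(14)] -/
theorem integrableOn_transportCoeff_Icc (hu : DriftBound T u U) (hθ : IsL2Field T E θ) (k : d → ℤ) :
    IntegrableOn (fun t => transportCoeff u θ t k) (Icc 0 T) volume := by
  rw [integrableOn_Icc_iff_integrableOn_Ioo]
  exact integrable_transportCoeff hu hθ k

/-- The exponentially weighted transport coefficient is integrable on `[0,T]`. [cite: Pazy1983, Ch. 4 §4.2, (2.3) and Def. 2.3 (mild solution), p. 106] -/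
theorem integrableOn_exp_mul_transportCoeff (hu : DriftBound T u U) (hθ : IsL2Field T E θ) (c : ℝ)
    (k : d → ℤ) :
    IntegrableOn (fun s => ((Real.exp (c * s) : ℝ) : ℂ) * transportCoeff u θ s k) (Icc 0 T) volume := by
  refine (integrableOn_transportCoeff_Icc hu hθ k).bdd_mul (c := Real.exp (|c| * |T|))
    (Complex.continuous_ofReal.comp (Real.continuous_exp.comp (continuous_const.mul continuous_id))
      |>.aestronglyMeasurable) ?_
  filter_upwards [ae_restrict_mem measurableSet_Icc] with s hs
  rw [Complex.norm_real, Real.norm_of_nonneg (Real.exp_pos _).le, Real.exp_le_exp]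
  calc c * s ≤ |c * s| := le_abs_self _
    _ = |c| * |s| := abs_mul c s
    _ ≤ |c| * |T| := by
        refine mul_le_mul_of_nonneg_left ?_ (abs_nonneg c)
        rw [abs_of_nonneg hs.1]
        exact hs.2.trans (le_abs_self T)

/-- **The Duhamel coefficient is continuous in time on `[0,T]`** at every frequency (a continuous
factor times the primitive of an integrable function). [cite: Pazy1983, Ch. 4 §4.2, (2.3) and Def. 2.3 (mild solution), p. 106] -/
theorem continuousOn_duhamelCoeff (hu : DriftBound T u U) (hθ : IsL2Field T E θ) (k : d → ℤ) :
    ContinuousOn (fun t => duhamelCoeff κ a lam u θ t k) (Icc 0 T) := by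
  have h1 : ContinuousOn (fun t => ∫ s in Ioc 0 t,
      ((Real.exp ((diagRate κ a k + lam) * s) : ℝ) : ℂ) * transportCoeff u θ s k) (Icc 0 T) :=
    intervalIntegral.continuousOn_primitive (integrableOn_exp_mul_transportCoeff hu hθ _ k)
  have h2 : Continuous fun t : ℝ => ((Real.exp (-((diagRate κ a k + lam) * t)) : ℝ) : ℂ) :=
    Complex.continuous_ofReal.comp (Real.continuous_exp.comp ((continuous_const.mul continuous_id).neg))
  refine (h2.continuousOn.mul h1).congr fun t _ => ?_
  exact duhamelCoeff_eq_exp_mul_integral κ a lam u θ t k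

/-- **Conjugate symmetry of the Duhamel coefficient**: `D(θ)(t)(-k) = conj (D(θ)(t)(k))`. [cite: Grafakos2014, Prop. 3.2.6 (4)] -/
theorem duhamelCoeff_neg (κ : ℝ) (a : d → ℝ) (lam : ℝ) (u : ℝ → UnitAddTorus d → EuclideanSpace ℝ d)
    (θ : ℝ → UnitAddTorus d → ℝ) (t : ℝ) (k : d → ℤ) :
    duhamelCoeff κ a lam u θ t (-k) = conj (duhamelCoeff κ a lam u θ t k) := by
  rw [duhamelCoeff_apply, duhamelCoeff_apply, ← integral_conj]
  refine integral_congr_ae (ae_of_all _ fun s => ?_)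
  dsimp only
  rw [diagRate_neg, transportCoeff_neg, map_mul, Complex.conj_ofReal]

/-- The Duhamel coefficient of the zero field vanishes. [cite: Pazy1983, Ch. 4 §4.2, (2.3) and Def. 2.3 (mild solution), p. 106] -/
theorem duhamelCoeff_zero_field (κ : ℝ) (a : d → ℝ) (lam : ℝ)
    (u : ℝ → UnitAddTorus d → EuclideanSpace ℝ d) (t : ℝ) (k : d → ℤ) :
    duhamelCoeff κ a lam u (fun _ _ => (0 : ℝ)) t k = 0 := by
  rw [duhamelCoeff_apply]
  have h : ∀ s, transportCoeff u (fun _ _ => (0 : ℝ)) s k = 0 := fun s => by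
    rw [transportCoeff_apply]
    refine Finset.sum_eq_zero fun j _ => ?_
    have : (fun x : UnitAddTorus d => ((u s x j * 0 : ℝ) : ℂ)) = fun _ => 0 := by
      funext x; simp
    rw [this, mFourierCoeff_eq_integral_volume]
    simp
  simp [h]

/-- For a.e. `s ∈ (0,T)` every product `uⱼ(s)θ(s)` is integrable. [cite: DiPernaLions1989, §II.1 (12)–(14)] -/
theorem ae_integrable_apply_mul (hu : DriftBound T u U) (hθ : IsL2Field T E θ) :
    ∀ᵐ s ∂((volume : Measure ℝ).restrict (Ioo 0 T)), ∀ j, Integrable (fun x => u s x j * θ s x) volume := by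
  rw [eventually_all]
  intro j
  filter_upwards [ae_memLp_apply_mul hu hθ j] with s hs
  exact hs.1.integrable one_le_two

/-- A.e. in time on `(0,T)`, the transport coefficient is linear in the field. [cite: Grafakos2014, Prop. 3.2.6 (8)] -/
theorem ae_transportCoeff_sub (hu : DriftBound T u U) (hθ : IsL2Field T E θ) {E' : ℝ}
    (hθ' : IsL2Field T E' θ') (k : d → ℤ) :
    ∀ᵐ s ∂((volume : Measure ℝ).restrict (Ioo 0 T)),
      transportCoeff u (fun t x => θ t x - θ' t x) s k = transportCoeff u θ s k - transportCoeff u θ' s k := by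
  filter_upwards [ae_integrable_apply_mul hu hθ, ae_integrable_apply_mul hu hθ'] with s hs hs'
  exact transportCoeff_sub hs hs' k

/-- Transfer of an a.e. statement on `(0,T)` to `(0,t]`, `t ≤ T`. [cite: DiPernaLions1989, §II.1 (12)–(14)] -/
theorem ae_restrict_Ioc_of_ae_restrict_Ioo {p : ℝ → Prop} {t : ℝ} (ht : t ≤ T)
    (h : ∀ᵐ s ∂((volume : Measure ℝ).restrict (Ioo 0 T)), p s) :
    ∀ᵐ s ∂((volume : Measure ℝ).restrict (Ioc 0 t)), p s := by
  have h1 : ∀ᵐ s ∂((volume : Measure ℝ).restrict (Ioc 0 T)), p s := by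
    rwa [← Measure.restrict_congr_set (Ioo_ae_eq_Ioc (μ := (volume : Measure ℝ)))]
  exact ae_restrict_of_ae_restrict_of_subset (Ioc_subset_Ioc_right ht) h1

/-- The damped kernel times the transport coefficient is integrable on `(0,t]`, `t ≤ T`. [cite: Pazy1983, Ch. 4 §4.2, (2.3) and Def. 2.3 (mild solution), p. 106] -/
theorem integrableOn_kernel_mul_transportCoeff (hu : DriftBound T u U) (hθ : IsL2Field T E θ)
    {t : ℝ} (ht : t ≤ T) (k : d → ℤ) :
    IntegrableOn (fun s => ((Real.exp (-((diagRate κ a k + lam) * (t - s))) : ℝ) : ℂ) *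
      transportCoeff u θ s k) (Ioc 0 t) volume := by
  have h0 : IntegrableOn (fun s => transportCoeff u θ s k) (Ioc 0 t) volume := by
    refine ((integrableOn_transportCoeff_Icc hu hθ k).mono_set ?_)
    exact Ioc_subset_Icc_self.trans (Icc_subset_Icc_right ht)
  refine h0.bdd_mul (c := Real.exp (|diagRate κ a k + lam| * (|t| + |t|)))
    (Complex.continuous_ofReal.comp (Real.continuous_exp.comp
      ((continuous_const.mul (continuous_const.sub continuous_id)).neg)) |>.aestronglyMeasurable) ?_
  filter_upwards [ae_restrict_mem measurableSet_Ioc] with s hs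
  rw [Complex.norm_real, Real.norm_of_nonneg (Real.exp_pos _).le, Real.exp_le_exp]
  have hs' : |s| ≤ |t| := by
    rw [abs_of_nonneg hs.1.le]
    exact hs.2.trans (le_abs_self t)
  calc -((diagRate κ a k + lam) * (t - s)) ≤ |(diagRate κ a k + lam) * (t - s)| := neg_le_abs _
    _ = |diagRate κ a k + lam| * |t - s| := abs_mul _ _
    _ ≤ |diagRate κ a k + lam| * (|t| + |t|) := by
        refine mul_le_mul_of_nonneg_left ((abs_sub _ _).trans (add_le_add le_rfl hs')) (abs_nonneg _)

/-- **Linearity of the Duhamel coefficient in the field** on `[0,T]`. [cite: Pazy1983, Ch. 4 §4.2, (2.3) and Def. 2.3 (mild solution), p. 106] -/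
theorem duhamelCoeff_sub (hu : DriftBound T u U) (hθ : IsL2Field T E θ) {E' : ℝ} (hθ' : IsL2Field T E' θ')
    {t : ℝ} (ht : t ≤ T) (k : d → ℤ) :
    duhamelCoeff κ a lam u (fun s x => θ s x - θ' s x) t k =
      duhamelCoeff κ a lam u θ t k - duhamelCoeff κ a lam u θ' t k := by
  rw [duhamelCoeff_apply, duhamelCoeff_apply, duhamelCoeff_apply,
    ← integral_sub (integrableOn_kernel_mul_transportCoeff hu hθ ht k)
      (integrableOn_kernel_mul_transportCoeff hu hθ' ht k)]
  refine integral_congr_ae ?_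
  filter_upwards [ae_restrict_Ioc_of_ae_restrict_Ioo ht (ae_transportCoeff_sub hu hθ hθ' k)] with s hs
  rw [hs, mul_sub]

/-- **Undamping**: for `θ = e^{λt} w`, the undamped Duhamel coefficient of `θ` is `e^{λt}` times
the `λ`-damped one of `w`: `D⁰(e^{λ·}w)(t) = e^{λt} D^λ(w)(t)` (`N(e^{λ·}w)(s) = e^{λs}N(w)(s)` and
`e^{-νₖ(t-s)} e^{λs} = e^{λt} e^{-(νₖ+λ)(t-s)}`). [cite: Pazy1983, Ch. 4 §4.2, (2.3) and Def. 2.3 (mild solution), p. 106] -/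
theorem duhamelCoeff_zero_exp_mul (κ : ℝ) (a : d → ℝ) (lam : ℝ)
    (u : ℝ → UnitAddTorus d → EuclideanSpace ℝ d) (w : ℝ → UnitAddTorus d → ℝ) (t : ℝ) (k : d → ℤ) :
    duhamelCoeff κ a 0 u (fun s x => Real.exp (lam * s) * w s x) t k =
      ((Real.exp (lam * t) : ℝ) : ℂ) * duhamelCoeff κ a lam u w t k := by
  rw [duhamelCoeff_apply, duhamelCoeff_apply, ← integral_const_mul]
  refine integral_congr_ae (ae_of_all _ fun s => ?_)
  dsimp only
  rw [transportCoeff_mul_left, ← mul_assoc, ← mul_assoc, ← Complex.ofReal_mul, ← Complex.ofReal_mul,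
    ← Real.exp_add, ← Real.exp_add]
  congr 3
  ring

/-- Continuity of the Picard map's values in time on `[0,T]`. [cite: Pazy1983, Ch. 4 §4.2, (2.3) and Def. 2.3 (mild solution), p. 106] -/
theorem continuousOn_mildMap (hu : DriftBound T u U) (hθ : IsL2Field T E θ) (θ₀ : UnitAddTorus d → ℝ)
    (k : d → ℤ) : ContinuousOn (fun t => mildMap κ a lam u θ₀ θ t k) (Icc 0 T) := by
  have h2 : Continuous fun t : ℝ => ((Real.exp (-((diagRate κ a k + lam) * t)) : ℝ) : ℂ) :=
    Complex.continuous_ofReal.comp (Real.continuous_exp.comp ((continuous_const.mul continuous_id).neg))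
  exact (h2.continuousOn.mul continuousOn_const).sub (continuousOn_duhamelCoeff hu hθ k)

/-- Conjugate symmetry of the Picard map's values: `Φ(θ)(t)(-k) = conj (Φ(θ)(t)(k))`. [cite: Grafakos2014, Prop. 3.2.6 (4)] -/
theorem mildMap_neg (κ : ℝ) (a : d → ℝ) (lam : ℝ) (u : ℝ → UnitAddTorus d → EuclideanSpace ℝ d)
    (θ₀ : UnitAddTorus d → ℝ) (θ : ℝ → UnitAddTorus d → ℝ) (t : ℝ) (k : d → ℤ) :
    mildMap κ a lam u θ₀ θ t (-k) = conj (mildMap κ a lam u θ₀ θ t k) := by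
  rw [mildMap_apply, mildMap_apply, map_sub, map_mul, Complex.conj_ofReal, diagRate_neg,
    duhamelCoeff_neg, mFourierCoeff_ofReal_comp]

end Duhamel

end Torus

end Literature.Analysis.FluidPDE

end
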